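/-
Copyright (c) 2026. All rights reserved.
Released under Apache 2.0 license as described in the file LICENSE.
-/
import Literature.Geometry.Kaehler.ComplexTorusQuaternionXSixSpecialCyclesDegreeClosedForm
import Literature.NumberTheory.Sieve.SquarefreeProgressions
import HarnessLib

/-!
# Primitive class numbers of special vectors on `X₆` by Möbius inversion, and `Z(t) ≤ Z(c²t)`:
# `|L(n²t₁)/O₆^×| = Σ_{i ∣ n} |L_prim(i²t₁)/O₆^×|`, `|L_prim(n²t₁)/O₆^×| = Σ_{ab = n} μ(a)·|L(b²t₁)/O₆^×|` (`t₁` squarefree)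

In Kudla–Rapoport–Yang's degree formula (3.4.4)–(3.4.6) for the special cycles `Z(t)` on the Shimura curve of discriminant
`D(B)` the class numbers enter through `H₀(t,D) = Σ_{c∣n} h(c²d)/w(c²d)` (`4t = n²d`), one term per quadratic ORDER
through which a special endomorphism can act; on the vector side (`D(B) = 6`, `B = (−1,3)_ℚ`, `O₆`, `L(t) = {x ∈ ℤ³ :
x₁² − 3x₂² − 3x₃² = t}`, classes modulo `Γ = O₆^×`) this is the CONTENT stratification of `…XSixSpecialCyclesContentCounts`:
`|L(t)/O₆^×| = Σ_{c=1}^{t} |L_c(t)/O₆^×|`, `L_c(t)` = primitive `p` with `c²Q(p) = t`. This file re-indexes the strata by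
the primitive norm `t/c²`, i.e. by the PRIMITIVE class numbers `P(m) = |L_prim(m)/O₆^×|` (`L_prim(m)` = primitive vectors
of norm `m`; Vignéras' embedding numbers of the order optimally embedded, `Σ_B m_G(B)`), and inverts:

* §1 `card_unit_classes_le_sq_mul`, `finsum_unit_classes_le_sq_mul`, `degree_le_degree_sq_mul`: the scaling map
  `[ŷ] ↦ [c·ŷ]`, `L(t)/O₆^× → L(c²t)/O₆^×` (`c ≠ 0`), is INJECTIVE and WEIGHT-PRESERVING (`e_{cy} = e_y`), so
  **`|L(t)/O₆^×| ≤ |L(c²t)/O₆^×|` and `deg Z(t)_ℚ ≤ deg Z(c²t)_ℚ`** (`t > 0`) — `Z(t) ≤ Z(c²t)` as weighted `0`-cycles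
  (`Pt(t) ⊆ Pt(c²t)`, `specialPoints_mono_sq_mul`), with equality for `c = 2^a3^b` (`finsum_unit_classes_pow_mul_eq`).
* §2 `card_stratum_eq_card_primitive`, `card_stratum_eq_zero_of_not_dvd`: the stratum `L_c(c²t₀)` IS `L_prim(t₀)`, and
  `L_c(t) = ∅` unless `c² ∣ t`.
* §3 `card_unit_classes_eq_sum_primitive`: **`|L(t)/O₆^×| = Σ_{c² ∣ t} P(t/c²)`** (`t > 0`); for `t = n²t₁` with `t₁`
  SQUAREFREE, `c² ∣ n²t₁ ⟺ c ∣ n` (the tree's `Literature.NumberTheory.Sieve.sq_dvd_sq_mul_iff_of_squarefree`), so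
  `card_unit_classes_sq_mul_eq_sum_divisors`:
  **`|L(n²t₁)/O₆^×| = Σ_{i ∣ n} P(i²t₁)`** — a divisor sum in `n`.
* §4 `card_primitive_eq_sum_moebius`: **MÖBIUS INVERSION `P(n²t₁) = Σ_{ab = n} μ(a)·|L(b²t₁)/O₆^×|`** (`t₁` squarefree,
  `n ≥ 1`; Mathlib's `ArithmeticFunction.sum_eq_iff_sum_mul_moebius_eq`).
* §5 values: `P(1) = P(3) = 2`, **`P(25) = |L(25)/O₆^×| − |L(1)/O₆^×| = 6 − 2 = 4`**, **`P(75) = 6 − 2 = 4`** (the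
  embedding numbers of the orders of discriminant `−100` and `−75`: `δ·h = 2·2`, pointer of `…SpecialCyclesDegree`),
  `P(100) = 0` (no primitive vector has norm divisible by `4`; consistent with `μ`: `6 − 6 − 2 + 2 = 0`).

## Sources

* [KRY] S. Kudla, M. Rapoport, T. Yang, *Modular Forms and Special Cycles on Shimura Curves*, Ann. of Math. Stud. 161
  (2006), §3.4 (3.4.4)–(3.4.6) («`H₀(t,D) = Σ_{c∣n} h(c²d)/w(c²d)` … the order `O_{c²d}` of conductor `c`»), (3.4.13)–(3.4.14),
  Remark 3.4.7 («the action of `ℤ[√−t]` extends to an action of the order `O_{n₀²d}`»), Prop. 3.4.6.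
  [cite: KudlaRapoportYang2006, §3.4 (3.4.4)–(3.4.6), (3.4.13)–(3.4.14), Remark 3.4.7]
* [Vignéras] M.-F. Vignéras, *Arithmétique des algèbres de quaternions*, LNM 800 (1980), Ch. I §4 p. 26 («la réunion disjointe `C(h) = ∪_B C(h,B)` quand `B` parcourt les ordres de `L`»),
  Ch. III §5.C Cor. 5.11–5.14 p. 82–83 («`Σ_B m_G(B)` où `B` parcourt les ordres de `K(h)` contenant `h`»).
  [cite: VignerasLNM800, Ch. I §4; Ch. III §5.C Cor. 5.11–5.14]
* [Apostol] T. M. Apostol, *Introduction to Analytic Number Theory* (1976), §2.7 Thm. 2.9 (Möbius inversion).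
  [cite: Apostol1976, §2.7 Thm. 2.9]

## Scope (honest)

Theorems only — no definitions, no named facts, no instances; `L_prim(m)` and all quotients are inline types. The primitive
class numbers are NOT evaluated in general (Eichler's optimal-embedding theorem); §5 derives four values from the table.
-/

set_option maxSynthPendingDepth 3

open Quaternion Function Literature.NumberTheory.QuadraticFields.Quadratic

namespace Literature.Geometry.Kaehler.ComplexTorus.QuaternionType

/-! ## §0 Helpers -/

section Helpers

/-- The pure vector of `c·y` (`c ∈ ℤ`) is `c •` the pure vector of `y`. [folklore] -/
private theorem pureVec_intMul₄₃ (c y₁ y₂ y₃ : ℤ) :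
    (⟨0, ((c * y₁ : ℤ) : ℚ), ((c * y₂ : ℤ) : ℚ), ((c * y₃ : ℤ) : ℚ)⟩ : ℍ[ℚ,((-1 : ℤ) : ℚ),((3 : ℤ) : ℚ)]) = (c : ℚ) • ⟨0, (y₁ : ℚ), (y₂ : ℚ), (y₃ : ℚ)⟩ := by
  rw [QuaternionAlgebra.smul_mk]; push_cast; simp only [smul_eq_mul, mul_zero]

/-- Transport of `|L(t)/O₆^×|` along an equality of norms. [folklore] -/
private theorem card_unit_classes_congr₄₃ {t₁ t₂ : ℤ} (h : t₁ = t₂) :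
    Nat.card (Quot (fun x y : {x : ℤ × ℤ × ℤ // x.1 ^ 2 - 3 * x.2.1 ^ 2 - 3 * x.2.2 ^ 2 = t₁} ↦
      ∃ v : ℍ[ℚ,((-1 : ℤ) : ℚ),((3 : ℤ) : ℚ)], (v ∈ order (-1) 3 ∨ v - ⟨1/2, 1/2, 1/2, -1/2⟩ ∈ order (-1) 3) ∧
        ((v * star v).re = 1 ∨ (v * star v).re = -1) ∧
        v * ⟨0, x.1.1, x.1.2.1, x.1.2.2⟩ = ⟨0, y.1.1, y.1.2.1, y.1.2.2⟩ * v)) = Nat.card (Quot (fun x y : {x : ℤ × ℤ × ℤ // x.1 ^ 2 - 3 * x.2.1 ^ 2 - 3 * x.2.2 ^ 2 = t₂} ↦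
      ∃ v : ℍ[ℚ,((-1 : ℤ) : ℚ),((3 : ℤ) : ℚ)], (v ∈ order (-1) 3 ∨ v - ⟨1/2, 1/2, 1/2, -1/2⟩ ∈ order (-1) 3) ∧
        ((v * star v).re = 1 ∨ (v * star v).re = -1) ∧
        v * ⟨0, x.1.1, x.1.2.1, x.1.2.2⟩ = ⟨0, y.1.1, y.1.2.1, y.1.2.2⟩ * v)) := by
  subst h; rfl

/-- Transport of `|L_prim(m)/O₆^×|` along an equality of norms. [folklore] -/
private theorem card_primitive_congr₄₃ {m₁ m₂ : ℤ} (h : m₁ = m₂) :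
    Nat.card (Quot (fun x y : {x : ℤ × ℤ × ℤ // x.1 ^ 2 - 3 * x.2.1 ^ 2 - 3 * x.2.2 ^ 2 = m₁ ∧
      ∃ u : ℤ × ℤ × ℤ, u.1 * x.1 + u.2.1 * x.2.1 + u.2.2 * x.2.2 = 1} ↦
      ∃ v : ℍ[ℚ,((-1 : ℤ) : ℚ),((3 : ℤ) : ℚ)], (v ∈ order (-1) 3 ∨ v - ⟨1/2, 1/2, 1/2, -1/2⟩ ∈ order (-1) 3) ∧
        ((v * star v).re = 1 ∨ (v * star v).re = -1) ∧
        v * ⟨0, x.1.1, x.1.2.1, x.1.2.2⟩ = ⟨0, y.1.1, y.1.2.1, y.1.2.2⟩ * v)) = Nat.card (Quot (fun x y : {x : ℤ × ℤ × ℤ // x.1 ^ 2 - 3 * x.2.1 ^ 2 - 3 * x.2.2 ^ 2 = m₂ ∧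
      ∃ u : ℤ × ℤ × ℤ, u.1 * x.1 + u.2.1 * x.2.1 + u.2.2 * x.2.2 = 1} ↦
      ∃ v : ℍ[ℚ,((-1 : ℤ) : ℚ),((3 : ℤ) : ℚ)], (v ∈ order (-1) 3 ∨ v - ⟨1/2, 1/2, 1/2, -1/2⟩ ∈ order (-1) 3) ∧
        ((v * star v).re = 1 ∨ (v * star v).re = -1) ∧
        v * ⟨0, x.1.1, x.1.2.1, x.1.2.2⟩ = ⟨0, y.1.1, y.1.2.1, y.1.2.2⟩ * v)) := by
  subst h; rfl

/-- Primitivity of a triple in `Fin 3` form. [folklore] -/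
private theorem prim_fin₄₃ {x : ℤ × ℤ × ℤ} (h : ∃ u : ℤ × ℤ × ℤ, u.1 * x.1 + u.2.1 * x.2.1 + u.2.2 * x.2.2 = 1) :
    ∃ w : Fin 3 → ℤ, ∑ k, w k * (![x.1, x.2.1, x.2.2] : Fin 3 → ℤ) k = 1 := by
  obtain ⟨u, hu⟩ := h
  exact ⟨![u.1, u.2.1, u.2.2], by simpa [Fin.sum_univ_three] using hu⟩

/-- **The scaling map `[ŷ] ↦ [c·ŷ]`, `L(t)/O₆^× → L(c²t)/O₆^×`, is injective and weight-preserving** (`c ≠ 0`):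
`conj_ratSmul_iff` (conjugation commutes with scaling) and `card_unitStab_smul` (`e_{cy} = e_y`). [folklore] -/
private theorem scale_map₄₃ (t : ℤ) {c : ℤ} (hc : c ≠ 0) :
    ∃ Φ : (Quot (fun x y : {x : ℤ × ℤ × ℤ // x.1 ^ 2 - 3 * x.2.1 ^ 2 - 3 * x.2.2 ^ 2 = t} ↦
      ∃ v : ℍ[ℚ,((-1 : ℤ) : ℚ),((3 : ℤ) : ℚ)], (v ∈ order (-1) 3 ∨ v - ⟨1/2, 1/2, 1/2, -1/2⟩ ∈ order (-1) 3) ∧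
        ((v * star v).re = 1 ∨ (v * star v).re = -1) ∧
        v * ⟨0, x.1.1, x.1.2.1, x.1.2.2⟩ = ⟨0, y.1.1, y.1.2.1, y.1.2.2⟩ * v)) → (Quot (fun x y : {x : ℤ × ℤ × ℤ // x.1 ^ 2 - 3 * x.2.1 ^ 2 - 3 * x.2.2 ^ 2 = c ^ 2 * t} ↦
      ∃ v : ℍ[ℚ,((-1 : ℤ) : ℚ),((3 : ℤ) : ℚ)], (v ∈ order (-1) 3 ∨ v - ⟨1/2, 1/2, 1/2, -1/2⟩ ∈ order (-1) 3) ∧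
        ((v * star v).re = 1 ∨ (v * star v).re = -1) ∧
        v * ⟨0, x.1.1, x.1.2.1, x.1.2.2⟩ = ⟨0, y.1.1, y.1.2.1, y.1.2.2⟩ * v)), Function.Injective Φ ∧
      ∀ q, ((Nat.card
          {u : ℍ[ℚ,((-1 : ℤ) : ℚ),((3 : ℤ) : ℚ)] // (u ∈ order (-1) 3 ∨ u - ⟨1/2, 1/2, 1/2, -1/2⟩ ∈ order (-1) 3) ∧
            ((u * star u).re = 1 ∨ (u * star u).re = -1) ∧
            u * ⟨0, (Φ q).out.1.1, (Φ q).out.1.2.1, (Φ q).out.1.2.2⟩ = ⟨0, (Φ q).out.1.1, (Φ q).out.1.2.1, (Φ q).out.1.2.2⟩ * u} : ℚ))⁻¹ = ((Nat.card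
          {u : ℍ[ℚ,((-1 : ℤ) : ℚ),((3 : ℤ) : ℚ)] // (u ∈ order (-1) 3 ∨ u - ⟨1/2, 1/2, 1/2, -1/2⟩ ∈ order (-1) 3) ∧
            ((u * star u).re = 1 ∨ (u * star u).re = -1) ∧
            u * ⟨0, q.out.1.1, q.out.1.2.1, q.out.1.2.2⟩ = ⟨0, q.out.1.1, q.out.1.2.1, q.out.1.2.2⟩ * u} : ℚ))⁻¹ := by
  have hc' : (c : ℚ) ≠ 0 := by exact_mod_cast hc
  set Rk : {x : ℤ × ℤ × ℤ // x.1 ^ 2 - 3 * x.2.1 ^ 2 - 3 * x.2.2 ^ 2 = c ^ 2 * t} → {x : ℤ × ℤ × ℤ // x.1 ^ 2 - 3 * x.2.1 ^ 2 - 3 * x.2.2 ^ 2 = c ^ 2 * t} → Prop := (fun x y : {x : ℤ × ℤ × ℤ // x.1 ^ 2 - 3 * x.2.1 ^ 2 - 3 * x.2.2 ^ 2 = c ^ 2 * t} ↦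
      ∃ v : ℍ[ℚ,((-1 : ℤ) : ℚ),((3 : ℤ) : ℚ)], (v ∈ order (-1) 3 ∨ v - ⟨1/2, 1/2, 1/2, -1/2⟩ ∈ order (-1) 3) ∧
        ((v * star v).re = 1 ∨ (v * star v).re = -1) ∧
        v * ⟨0, x.1.1, x.1.2.1, x.1.2.2⟩ = ⟨0, y.1.1, y.1.2.1, y.1.2.2⟩ * v) with hRk
  set R : {x : ℤ × ℤ × ℤ // x.1 ^ 2 - 3 * x.2.1 ^ 2 - 3 * x.2.2 ^ 2 = t} → {x : ℤ × ℤ × ℤ // x.1 ^ 2 - 3 * x.2.1 ^ 2 - 3 * x.2.2 ^ 2 = t} → Prop := (fun x y : {x : ℤ × ℤ × ℤ // x.1 ^ 2 - 3 * x.2.1 ^ 2 - 3 * x.2.2 ^ 2 = t} ↦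
      ∃ v : ℍ[ℚ,((-1 : ℤ) : ℚ),((3 : ℤ) : ℚ)], (v ∈ order (-1) 3 ∨ v - ⟨1/2, 1/2, 1/2, -1/2⟩ ∈ order (-1) 3) ∧
        ((v * star v).re = 1 ∨ (v * star v).re = -1) ∧
        v * ⟨0, x.1.1, x.1.2.1, x.1.2.2⟩ = ⟨0, y.1.1, y.1.2.1, y.1.2.2⟩ * v) with hR
  have hiff : ∀ x y, Quot.mk Rk x = Quot.mk Rk y ↔ Rk x y := unit_conj_mk_eq_iff (c ^ 2 * t)
  set sc : {x : ℤ × ℤ × ℤ // x.1 ^ 2 - 3 * x.2.1 ^ 2 - 3 * x.2.2 ^ 2 = t} → {x : ℤ × ℤ × ℤ // x.1 ^ 2 - 3 * x.2.1 ^ 2 - 3 * x.2.2 ^ 2 = c ^ 2 * t} := fun y ↦ ⟨(c * y.1.1, c * y.1.2.1, c * y.1.2.2), by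
    show (c * y.1.1) ^ 2 - 3 * (c * y.1.2.1) ^ 2 - 3 * (c * y.1.2.2) ^ 2 = c ^ 2 * t
    linear_combination (c ^ 2 : ℤ) * y.2⟩ with hsc
  have hsc_vec : ∀ y : {x : ℤ × ℤ × ℤ // x.1 ^ 2 - 3 * x.2.1 ^ 2 - 3 * x.2.2 ^ 2 = t}, (⟨0, (sc y).1.1, (sc y).1.2.1, (sc y).1.2.2⟩ : ℍ[ℚ,((-1 : ℤ) : ℚ),((3 : ℤ) : ℚ)]) = (c : ℚ) • ⟨0, y.1.1, y.1.2.1, y.1.2.2⟩ := fun y ↦ pureVec_intMul₄₃ c _ _ _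
  have csc : ∀ y y', R y y' → Rk (sc y) (sc y') := by
    rintro y y' ⟨g, hg, hn, h⟩
    refine ⟨g, hg, hn, ?_⟩
    rw [hsc_vec, hsc_vec, conj_ratSmul_iff hc']
    exact h
  have hout : ∀ y : {x : ℤ × ℤ × ℤ // x.1 ^ 2 - 3 * x.2.1 ^ 2 - 3 * x.2.2 ^ 2 = t}, Nat.card {u : ℍ[ℚ,((-1 : ℤ) : ℚ),((3 : ℤ) : ℚ)] // (u ∈ order (-1) 3 ∨ u - ⟨1/2, 1/2, 1/2, -1/2⟩ ∈ order (-1) 3) ∧ ((u * star u).re = 1 ∨ (u * star u).re = -1) ∧ u * (⟨0, ((Quot.mk R y).out).1.1, ((Quot.mk R y).out).1.2.1, ((Quot.mk R y).out).1.2.2⟩ : ℍ[ℚ,((-1 : ℤ) : ℚ),((3 : ℤ) : ℚ)]) = (⟨0, ((Quot.mk R y).out).1.1, ((Quot.mk R y).out).1.2.1, ((Quot.mk R y).out).1.2.2⟩ : ℍ[ℚ,((-1 : ℤ) : ℚ),((3 : ℤ) : ℚ)]) * u} =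
      Nat.card {u : ℍ[ℚ,((-1 : ℤ) : ℚ),((3 : ℤ) : ℚ)] // (u ∈ order (-1) 3 ∨ u - ⟨1/2, 1/2, 1/2, -1/2⟩ ∈ order (-1) 3) ∧ ((u * star u).re = 1 ∨ (u * star u).re = -1) ∧ u * (⟨0, y.1.1, y.1.2.1, y.1.2.2⟩ : ℍ[ℚ,((-1 : ℤ) : ℚ),((3 : ℤ) : ℚ)]) = (⟨0, y.1.1, y.1.2.1, y.1.2.2⟩ : ℍ[ℚ,((-1 : ℤ) : ℚ),((3 : ℤ) : ℚ)]) * u} := card_unitStab_mk_out t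
  have houtk : ∀ x : {x : ℤ × ℤ × ℤ // x.1 ^ 2 - 3 * x.2.1 ^ 2 - 3 * x.2.2 ^ 2 = c ^ 2 * t}, Nat.card {u : ℍ[ℚ,((-1 : ℤ) : ℚ),((3 : ℤ) : ℚ)] // (u ∈ order (-1) 3 ∨ u - ⟨1/2, 1/2, 1/2, -1/2⟩ ∈ order (-1) 3) ∧ ((u * star u).re = 1 ∨ (u * star u).re = -1) ∧ u * (⟨0, ((Quot.mk Rk x).out).1.1, ((Quot.mk Rk x).out).1.2.1, ((Quot.mk Rk x).out).1.2.2⟩ : ℍ[ℚ,((-1 : ℤ) : ℚ),((3 : ℤ) : ℚ)]) = (⟨0, ((Quot.mk Rk x).out).1.1, ((Quot.mk Rk x).out).1.2.1, ((Quot.mk Rk x).out).1.2.2⟩ : ℍ[ℚ,((-1 : ℤ) : ℚ),((3 : ℤ) : ℚ)]) * u} =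
      Nat.card {u : ℍ[ℚ,((-1 : ℤ) : ℚ),((3 : ℤ) : ℚ)] // (u ∈ order (-1) 3 ∨ u - ⟨1/2, 1/2, 1/2, -1/2⟩ ∈ order (-1) 3) ∧ ((u * star u).re = 1 ∨ (u * star u).re = -1) ∧ u * (⟨0, x.1.1, x.1.2.1, x.1.2.2⟩ : ℍ[ℚ,((-1 : ℤ) : ℚ),((3 : ℤ) : ℚ)]) = (⟨0, x.1.1, x.1.2.1, x.1.2.2⟩ : ℍ[ℚ,((-1 : ℤ) : ℚ),((3 : ℤ) : ℚ)]) * u} := card_unitStab_mk_out (c ^ 2 * t)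
  refine ⟨Quot.map sc csc, ?_, ?_⟩
  · intro a b
    induction a using Quot.ind with
    | _ y =>
      induction b using Quot.ind with
      | _ y' =>
        intro h
        change Quot.mk Rk (sc y) = Quot.mk Rk (sc y') at h
        rw [hiff] at h
        obtain ⟨g, hg, hn, h⟩ := h
        rw [hsc_vec, hsc_vec, conj_ratSmul_iff hc'] at h
        exact Quot.sound ⟨g, hg, hn, h⟩
  · intro q
    induction q using Quot.ind with
    | _ y =>
      show ((Nat.card {u : ℍ[ℚ,((-1 : ℤ) : ℚ),((3 : ℤ) : ℚ)] // (u ∈ order (-1) 3 ∨ u - ⟨1/2, 1/2, 1/2, -1/2⟩ ∈ order (-1) 3) ∧ ((u * star u).re = 1 ∨ (u * star u).re = -1) ∧ u * (⟨0, ((Quot.mk Rk (sc y)).out).1.1, ((Quot.mk Rk (sc y)).out).1.2.1, ((Quot.mk Rk (sc y)).out).1.2.2⟩ : ℍ[ℚ,((-1 : ℤ) : ℚ),((3 : ℤ) : ℚ)]) = (⟨0, ((Quot.mk Rk (sc y)).out).1.1, ((Quot.mk Rk (sc y)).out).1.2.1, ((Quot.mk Rk (sc y)).out).1.2.2⟩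 : ℍ[ℚ,((-1 : ℤ) : ℚ),((3 : ℤ) : ℚ)]) * u} : ℚ))⁻¹ =
        ((Nat.card {u : ℍ[ℚ,((-1 : ℤ) : ℚ),((3 : ℤ) : ℚ)] // (u ∈ order (-1) 3 ∨ u - ⟨1/2, 1/2, 1/2, -1/2⟩ ∈ order (-1) 3) ∧ ((u * star u).re = 1 ∨ (u * star u).re = -1) ∧ u * (⟨0, ((Quot.mk R y).out).1.1, ((Quot.mk R y).out).1.2.1, ((Quot.mk R y).out).1.2.2⟩ : ℍ[ℚ,((-1 : ℤ) : ℚ),((3 : ℤ) : ℚ)]) = (⟨0, ((Quot.mk R y).out).1.1, ((Quot.mk R y).out).1.2.1, ((Quot.mk R y).out).1.2.2⟩ : ℍ[ℚ,((-1 : ℤ) : ℚ),((3 : ℤ) : ℚ)]) * u} : ℚ))⁻¹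
      rw [houtk, hsc_vec, card_unitStab_smul hc', hout]

end Helpers

/-! ## §1 `Z(t) ≤ Z(c²t)`: the scaling injection, monotonicity of `|L(t)/O₆^×|` and of the degree -/

section Monotone

/-- **`|L(t)/O₆^×| ≤ |L(c²t)/O₆^×|` for `t > 0`, `c ≠ 0`** — `[ŷ] ↦ [c·ŷ]` is injective on Kudla–Rapoport–Yang's index sets
(`u(cŷ)u⁻¹ = cŷ′ ⟺ uŷu⁻¹ = ŷ′`); its image is the stratum of content divisible by `c`. [cite: KudlaRapoportYang2006, §3.4 (3.4.6) and (3.4.13)] [cite: VignerasLNM800, Ch. I §4 p. 26] -/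
theorem card_unit_classes_le_sq_mul {t : ℤ} (ht : 0 < t) {c : ℤ} (hc : c ≠ 0) :
    Nat.card (Quot (fun x y : {x : ℤ × ℤ × ℤ // x.1 ^ 2 - 3 * x.2.1 ^ 2 - 3 * x.2.2 ^ 2 = t} ↦
      ∃ v : ℍ[ℚ,((-1 : ℤ) : ℚ),((3 : ℤ) : ℚ)], (v ∈ order (-1) 3 ∨ v - ⟨1/2, 1/2, 1/2, -1/2⟩ ∈ order (-1) 3) ∧
        ((v * star v).re = 1 ∨ (v * star v).re = -1) ∧
        v * ⟨0, x.1.1, x.1.2.1, x.1.2.2⟩ = ⟨0, y.1.1, y.1.2.1, y.1.2.2⟩ * v)) ≤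
    Nat.card (Quot (fun x y : {x : ℤ × ℤ × ℤ // x.1 ^ 2 - 3 * x.2.1 ^ 2 - 3 * x.2.2 ^ 2 = c ^ 2 * t} ↦
      ∃ v : ℍ[ℚ,((-1 : ℤ) : ℚ),((3 : ℤ) : ℚ)], (v ∈ order (-1) 3 ∨ v - ⟨1/2, 1/2, 1/2, -1/2⟩ ∈ order (-1) 3) ∧
        ((v * star v).re = 1 ∨ (v * star v).re = -1) ∧
        v * ⟨0, x.1.1, x.1.2.1, x.1.2.2⟩ = ⟨0, y.1.1, y.1.2.1, y.1.2.2⟩ * v)) := by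
  haveI := finite_unit_classes (show 0 < c ^ 2 * t by positivity)
  obtain ⟨Φ, hinj, -⟩ := scale_map₄₃ t hc
  exact Nat.card_le_card_of_injective Φ hinj

/-- **`Σᶠ_{L(t)/O₆^×} e⁻¹ ≤ Σᶠ_{L(c²t)/O₆^×} e⁻¹` for `t > 0`, `c ≠ 0`** — the injection `[ŷ] ↦ [c·ŷ]` preserves the weights
`e_{cy}⁻¹ = e_y⁻¹` and all weights are `≥ 0`. [cite: KudlaRapoportYang2006, §3.4 (3.4.13)–(3.4.14)] -/
theorem finsum_unit_classes_le_sq_mul {t : ℤ} (ht : 0 < t) {c : ℤ} (hc : c ≠ 0) :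
    ∑ᶠ q : (Quot (fun x y : {x : ℤ × ℤ × ℤ // x.1 ^ 2 - 3 * x.2.1 ^ 2 - 3 * x.2.2 ^ 2 = t} ↦
      ∃ v : ℍ[ℚ,((-1 : ℤ) : ℚ),((3 : ℤ) : ℚ)], (v ∈ order (-1) 3 ∨ v - ⟨1/2, 1/2, 1/2, -1/2⟩ ∈ order (-1) 3) ∧
        ((v * star v).re = 1 ∨ (v * star v).re = -1) ∧
        v * ⟨0, x.1.1, x.1.2.1, x.1.2.2⟩ = ⟨0, y.1.1, y.1.2.1, y.1.2.2⟩ * v)),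
        ((Nat.card
          {u : ℍ[ℚ,((-1 : ℤ) : ℚ),((3 : ℤ) : ℚ)] // (u ∈ order (-1) 3 ∨ u - ⟨1/2, 1/2, 1/2, -1/2⟩ ∈ order (-1) 3) ∧
            ((u * star u).re = 1 ∨ (u * star u).re = -1) ∧
            u * ⟨0, q.out.1.1, q.out.1.2.1, q.out.1.2.2⟩ = ⟨0, q.out.1.1, q.out.1.2.1, q.out.1.2.2⟩ * u} : ℚ))⁻¹ ≤
    ∑ᶠ q : (Quot (fun x y : {x : ℤ × ℤ × ℤ // x.1 ^ 2 - 3 * x.2.1 ^ 2 - 3 * x.2.2 ^ 2 = c ^ 2 * t} ↦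
      ∃ v : ℍ[ℚ,((-1 : ℤ) : ℚ),((3 : ℤ) : ℚ)], (v ∈ order (-1) 3 ∨ v - ⟨1/2, 1/2, 1/2, -1/2⟩ ∈ order (-1) 3) ∧
        ((v * star v).re = 1 ∨ (v * star v).re = -1) ∧
        v * ⟨0, x.1.1, x.1.2.1, x.1.2.2⟩ = ⟨0, y.1.1, y.1.2.1, y.1.2.2⟩ * v)),
        ((Nat.card
          {u : ℍ[ℚ,((-1 : ℤ) : ℚ),((3 : ℤ) : ℚ)] // (u ∈ order (-1) 3 ∨ u - ⟨1/2, 1/2, 1/2, -1/2⟩ ∈ order (-1) 3) ∧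
            ((u * star u).re = 1 ∨ (u * star u).re = -1) ∧
            u * ⟨0, q.out.1.1, q.out.1.2.1, q.out.1.2.2⟩ = ⟨0, q.out.1.1, q.out.1.2.1, q.out.1.2.2⟩ * u} : ℚ))⁻¹ := by
  classical
  haveI := finite_unit_classes ht
  haveI := finite_unit_classes (show 0 < c ^ 2 * t by positivity)
  haveI := Fintype.ofFinite (Quot (fun x y : {x : ℤ × ℤ × ℤ // x.1 ^ 2 - 3 * x.2.1 ^ 2 - 3 * x.2.2 ^ 2 = t} ↦
      ∃ v : ℍ[ℚ,((-1 : ℤ) : ℚ),((3 : ℤ) : ℚ)], (v ∈ order (-1) 3 ∨ v - ⟨1/2, 1/2, 1/2, -1/2⟩ ∈ order (-1) 3) ∧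
        ((v * star v).re = 1 ∨ (v * star v).re = -1) ∧
        v * ⟨0, x.1.1, x.1.2.1, x.1.2.2⟩ = ⟨0, y.1.1, y.1.2.1, y.1.2.2⟩ * v))
  haveI := Fintype.ofFinite (Quot (fun x y : {x : ℤ × ℤ × ℤ // x.1 ^ 2 - 3 * x.2.1 ^ 2 - 3 * x.2.2 ^ 2 = c ^ 2 * t} ↦
      ∃ v : ℍ[ℚ,((-1 : ℤ) : ℚ),((3 : ℤ) : ℚ)], (v ∈ order (-1) 3 ∨ v - ⟨1/2, 1/2, 1/2, -1/2⟩ ∈ order (-1) 3) ∧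
        ((v * star v).re = 1 ∨ (v * star v).re = -1) ∧
        v * ⟨0, x.1.1, x.1.2.1, x.1.2.2⟩ = ⟨0, y.1.1, y.1.2.1, y.1.2.2⟩ * v))
  obtain ⟨Φ, hinj, hw⟩ := scale_map₄₃ t hc
  rw [finsum_eq_sum_of_fintype, finsum_eq_sum_of_fintype]
  calc ∑ q : (Quot (fun x y : {x : ℤ × ℤ × ℤ // x.1 ^ 2 - 3 * x.2.1 ^ 2 - 3 * x.2.2 ^ 2 = t} ↦
      ∃ v : ℍ[ℚ,((-1 : ℤ) : ℚ),((3 : ℤ) : ℚ)], (v ∈ order (-1) 3 ∨ v - ⟨1/2, 1/2, 1/2, -1/2⟩ ∈ order (-1) 3) ∧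
        ((v * star v).re = 1 ∨ (v * star v).re = -1) ∧
        v * ⟨0, x.1.1, x.1.2.1, x.1.2.2⟩ = ⟨0, y.1.1, y.1.2.1, y.1.2.2⟩ * v)), ((Nat.card
          {u : ℍ[ℚ,((-1 : ℤ) : ℚ),((3 : ℤ) : ℚ)] // (u ∈ order (-1) 3 ∨ u - ⟨1/2, 1/2, 1/2, -1/2⟩ ∈ order (-1) 3) ∧
            ((u * star u).re = 1 ∨ (u * star u).re = -1) ∧
            u * ⟨0, q.out.1.1, q.out.1.2.1, q.out.1.2.2⟩ = ⟨0, q.out.1.1, q.out.1.2.1, q.out.1.2.2⟩ * u} : ℚ))⁻¹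
      = ∑ q : (Quot (fun x y : {x : ℤ × ℤ × ℤ // x.1 ^ 2 - 3 * x.2.1 ^ 2 - 3 * x.2.2 ^ 2 = t} ↦
      ∃ v : ℍ[ℚ,((-1 : ℤ) : ℚ),((3 : ℤ) : ℚ)], (v ∈ order (-1) 3 ∨ v - ⟨1/2, 1/2, 1/2, -1/2⟩ ∈ order (-1) 3) ∧
        ((v * star v).re = 1 ∨ (v * star v).re = -1) ∧
        v * ⟨0, x.1.1, x.1.2.1, x.1.2.2⟩ = ⟨0, y.1.1, y.1.2.1, y.1.2.2⟩ * v)), ((Nat.card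
          {u : ℍ[ℚ,((-1 : ℤ) : ℚ),((3 : ℤ) : ℚ)] // (u ∈ order (-1) 3 ∨ u - ⟨1/2, 1/2, 1/2, -1/2⟩ ∈ order (-1) 3) ∧
            ((u * star u).re = 1 ∨ (u * star u).re = -1) ∧
            u * ⟨0, (Φ q).out.1.1, (Φ q).out.1.2.1, (Φ q).out.1.2.2⟩ = ⟨0, (Φ q).out.1.1, (Φ q).out.1.2.1, (Φ q).out.1.2.2⟩ * u} : ℚ))⁻¹ := Finset.sum_congr rfl fun q _ ↦ (hw q).symm
    _ = ∑ q' ∈ (Finset.univ : Finset (Quot (fun x y : {x : ℤ × ℤ × ℤ // x.1 ^ 2 - 3 * x.2.1 ^ 2 - 3 * x.2.2 ^ 2 = t} ↦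
      ∃ v : ℍ[ℚ,((-1 : ℤ) : ℚ),((3 : ℤ) : ℚ)], (v ∈ order (-1) 3 ∨ v - ⟨1/2, 1/2, 1/2, -1/2⟩ ∈ order (-1) 3) ∧
        ((v * star v).re = 1 ∨ (v * star v).re = -1) ∧
        v * ⟨0, x.1.1, x.1.2.1, x.1.2.2⟩ = ⟨0, y.1.1, y.1.2.1, y.1.2.2⟩ * v))).image Φ, ((Nat.card
          {u : ℍ[ℚ,((-1 : ℤ) : ℚ),((3 : ℤ) : ℚ)] // (u ∈ order (-1) 3 ∨ u - ⟨1/2, 1/2, 1/2, -1/2⟩ ∈ order (-1) 3) ∧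
            ((u * star u).re = 1 ∨ (u * star u).re = -1) ∧
            u * ⟨0, q'.out.1.1, q'.out.1.2.1, q'.out.1.2.2⟩ = ⟨0, q'.out.1.1, q'.out.1.2.1, q'.out.1.2.2⟩ * u} : ℚ))⁻¹ := by
        rw [Finset.sum_image fun x _ y _ h ↦ hinj h]
    _ ≤ ∑ q' : (Quot (fun x y : {x : ℤ × ℤ × ℤ // x.1 ^ 2 - 3 * x.2.1 ^ 2 - 3 * x.2.2 ^ 2 = c ^ 2 * t} ↦
      ∃ v : ℍ[ℚ,((-1 : ℤ) : ℚ),((3 : ℤ) : ℚ)], (v ∈ order (-1) 3 ∨ v - ⟨1/2, 1/2, 1/2, -1/2⟩ ∈ order (-1) 3) ∧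
        ((v * star v).re = 1 ∨ (v * star v).re = -1) ∧
        v * ⟨0, x.1.1, x.1.2.1, x.1.2.2⟩ = ⟨0, y.1.1, y.1.2.1, y.1.2.2⟩ * v)), ((Nat.card
          {u : ℍ[ℚ,((-1 : ℤ) : ℚ),((3 : ℤ) : ℚ)] // (u ∈ order (-1) 3 ∨ u - ⟨1/2, 1/2, 1/2, -1/2⟩ ∈ order (-1) 3) ∧
            ((u * star u).re = 1 ∨ (u * star u).re = -1) ∧
            u * ⟨0, q'.out.1.1, q'.out.1.2.1, q'.out.1.2.2⟩ = ⟨0, q'.out.1.1, q'.out.1.2.1, q'.out.1.2.2⟩ * u} : ℚ))⁻¹ :=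
        Finset.sum_le_sum_of_subset_of_nonneg (Finset.subset_univ _) fun q' _ _ ↦ inv_nonneg.2 (Nat.cast_nonneg _)

/-- **`deg Z(t)_ℚ ≤ deg Z(c²t)_ℚ` for every `t > 0` and `c ≠ 0`: `Z(t) ≤ Z(c²t)` as weighted `0`-cycles on `X₆`** — every
class of `L(t)` reappears in `L(c²t)` with content multiplied by `|c|` and the same stabiliser; equality holds for
`c = 2^a3^b` (`finsum_unit_classes_pow_mul_eq`); in general the difference is carried by the classes of `L(c²t)` whose
content is not a multiple of `c` (§3). [cite: KudlaRapoportYang2006, §3.4 (3.4.6), Prop. 3.4.6 and (3.4.14)] -/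
theorem degree_le_degree_sq_mul {t : ℤ} (ht : 0 < t) {c : ℤ} (hc : c ≠ 0) :
    2 * ∑ᶠ q : (Quot (fun x y : {x : ℤ × ℤ × ℤ // x.1 ^ 2 - 3 * x.2.1 ^ 2 - 3 * x.2.2 ^ 2 = t} ↦
      ∃ v : ℍ[ℚ,((-1 : ℤ) : ℚ),((3 : ℤ) : ℚ)], (v ∈ order (-1) 3 ∨ v - ⟨1/2, 1/2, 1/2, -1/2⟩ ∈ order (-1) 3) ∧
        ((v * star v).re = 1 ∨ (v * star v).re = -1) ∧
        v * ⟨0, x.1.1, x.1.2.1, x.1.2.2⟩ = ⟨0, y.1.1, y.1.2.1, y.1.2.2⟩ * v)),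
        ((Nat.card
          {u : ℍ[ℚ,((-1 : ℤ) : ℚ),((3 : ℤ) : ℚ)] // (u ∈ order (-1) 3 ∨ u - ⟨1/2, 1/2, 1/2, -1/2⟩ ∈ order (-1) 3) ∧
            ((u * star u).re = 1 ∨ (u * star u).re = -1) ∧
            u * ⟨0, q.out.1.1, q.out.1.2.1, q.out.1.2.2⟩ = ⟨0, q.out.1.1, q.out.1.2.1, q.out.1.2.2⟩ * u} : ℚ))⁻¹ ≤
    2 * ∑ᶠ q : (Quot (fun x y : {x : ℤ × ℤ × ℤ // x.1 ^ 2 - 3 * x.2.1 ^ 2 - 3 * x.2.2 ^ 2 = c ^ 2 * t} ↦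
      ∃ v : ℍ[ℚ,((-1 : ℤ) : ℚ),((3 : ℤ) : ℚ)], (v ∈ order (-1) 3 ∨ v - ⟨1/2, 1/2, 1/2, -1/2⟩ ∈ order (-1) 3) ∧
        ((v * star v).re = 1 ∨ (v * star v).re = -1) ∧
        v * ⟨0, x.1.1, x.1.2.1, x.1.2.2⟩ = ⟨0, y.1.1, y.1.2.1, y.1.2.2⟩ * v)),
        ((Nat.card
          {u : ℍ[ℚ,((-1 : ℤ) : ℚ),((3 : ℤ) : ℚ)] // (u ∈ order (-1) 3 ∨ u - ⟨1/2, 1/2, 1/2, -1/2⟩ ∈ order (-1) 3) ∧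
            ((u * star u).re = 1 ∨ (u * star u).re = -1) ∧
            u * ⟨0, q.out.1.1, q.out.1.2.1, q.out.1.2.2⟩ = ⟨0, q.out.1.1, q.out.1.2.1, q.out.1.2.2⟩ * u} : ℚ))⁻¹ := by
  have h := finsum_unit_classes_le_sq_mul ht hc
  linarith

end Monotone

/-! ## §2 The strata re-indexed by the primitive norm -/

section Strata

/-- **`L_c(c²t₀) = L_prim(t₀)`**: the stratum of content `c` in norm `T = c²t₀` is the set of primitive vectors of norm `t₀`,
class for class (`O₆^×`-conjugacy on the primitive parts). [cite: KudlaRapoportYang2006, §3.4 (3.4.6) and Remark 3.4.7] [cite: VignerasLNM800, Ch. III §5.C Cor. 5.14] -/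
theorem card_stratum_eq_card_primitive {T t₀ : ℤ} {c : ℕ} (hc : 0 < c) (h : (c : ℤ) ^ 2 * t₀ = T) :
    Nat.card (Quot (fun x y : {x : ℤ × ℤ × ℤ // (c : ℤ) ^ 2 * (x.1 ^ 2 - 3 * x.2.1 ^ 2 - 3 * x.2.2 ^ 2) = T ∧
      ∃ u : ℤ × ℤ × ℤ, u.1 * x.1 + u.2.1 * x.2.1 + u.2.2 * x.2.2 = 1} ↦
      ∃ v : ℍ[ℚ,((-1 : ℤ) : ℚ),((3 : ℤ) : ℚ)], (v ∈ order (-1) 3 ∨ v - ⟨1/2, 1/2, 1/2, -1/2⟩ ∈ order (-1) 3) ∧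
        ((v * star v).re = 1 ∨ (v * star v).re = -1) ∧
        v * ⟨0, x.1.1, x.1.2.1, x.1.2.2⟩ = ⟨0, y.1.1, y.1.2.1, y.1.2.2⟩ * v)) =
    Nat.card (Quot (fun x y : {x : ℤ × ℤ × ℤ // x.1 ^ 2 - 3 * x.2.1 ^ 2 - 3 * x.2.2 ^ 2 = t₀ ∧
      ∃ u : ℤ × ℤ × ℤ, u.1 * x.1 + u.2.1 * x.2.1 + u.2.2 * x.2.2 = 1} ↦
      ∃ v : ℍ[ℚ,((-1 : ℤ) : ℚ),((3 : ℤ) : ℚ)], (v ∈ order (-1) 3 ∨ v - ⟨1/2, 1/2, 1/2, -1/2⟩ ∈ order (-1) 3) ∧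
        ((v * star v).re = 1 ∨ (v * star v).re = -1) ∧
        v * ⟨0, x.1.1, x.1.2.1, x.1.2.2⟩ = ⟨0, y.1.1, y.1.2.1, y.1.2.2⟩ * v)) := by
  have hc2 : (c : ℤ) ^ 2 ≠ 0 := by positivity
  have key : ∀ x : ℤ × ℤ × ℤ, ((c : ℤ) ^ 2 * (x.1 ^ 2 - 3 * x.2.1 ^ 2 - 3 * x.2.2 ^ 2) = T ∧
      ∃ u : ℤ × ℤ × ℤ, u.1 * x.1 + u.2.1 * x.2.1 + u.2.2 * x.2.2 = 1) ↔
      ((x.1 ^ 2 - 3 * x.2.1 ^ 2 - 3 * x.2.2 ^ 2) = t₀ ∧ ∃ u : ℤ × ℤ × ℤ, u.1 * x.1 + u.2.1 * x.2.1 + u.2.2 * x.2.2 = 1) := by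
    intro x
    constructor
    · rintro ⟨hQ, hp⟩
      exact ⟨mul_left_cancel₀ hc2 (hQ.trans h.symm), hp⟩
    · rintro ⟨hQ, hp⟩
      exact ⟨by rw [hQ, h], hp⟩
  exact Nat.card_congr (Quot.congr (Equiv.subtypeEquivRight key) fun _ _ ↦ Iff.rfl)

/-- **`L_c(T) = ∅` unless `c² ∣ T`** (a primitive `p` with `c²Q(p) = T` exhibits `c² ∣ T`). [cite: KudlaRapoportYang2006, §3.4 (3.4.6)] -/
theorem card_stratum_eq_zero_of_not_dvd {T : ℤ} {c : ℕ} (h : ¬ (c : ℤ) ^ 2 ∣ T) :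
    Nat.card (Quot (fun x y : {x : ℤ × ℤ × ℤ // (c : ℤ) ^ 2 * (x.1 ^ 2 - 3 * x.2.1 ^ 2 - 3 * x.2.2 ^ 2) = T ∧
      ∃ u : ℤ × ℤ × ℤ, u.1 * x.1 + u.2.1 * x.2.1 + u.2.2 * x.2.2 = 1} ↦
      ∃ v : ℍ[ℚ,((-1 : ℤ) : ℚ),((3 : ℤ) : ℚ)], (v ∈ order (-1) 3 ∨ v - ⟨1/2, 1/2, 1/2, -1/2⟩ ∈ order (-1) 3) ∧
        ((v * star v).re = 1 ∨ (v * star v).re = -1) ∧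
        v * ⟨0, x.1.1, x.1.2.1, x.1.2.2⟩ = ⟨0, y.1.1, y.1.2.1, y.1.2.2⟩ * v)) = 0 := by
  haveI : IsEmpty (Quot (fun x y : {x : ℤ × ℤ × ℤ // (c : ℤ) ^ 2 * (x.1 ^ 2 - 3 * x.2.1 ^ 2 - 3 * x.2.2 ^ 2) = T ∧
      ∃ u : ℤ × ℤ × ℤ, u.1 * x.1 + u.2.1 * x.2.1 + u.2.2 * x.2.2 = 1} ↦
      ∃ v : ℍ[ℚ,((-1 : ℤ) : ℚ),((3 : ℤ) : ℚ)], (v ∈ order (-1) 3 ∨ v - ⟨1/2, 1/2, 1/2, -1/2⟩ ∈ order (-1) 3) ∧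
        ((v * star v).re = 1 ∨ (v * star v).re = -1) ∧
        v * ⟨0, x.1.1, x.1.2.1, x.1.2.2⟩ = ⟨0, y.1.1, y.1.2.1, y.1.2.2⟩ * v)) := ⟨fun q ↦ Quot.inductionOn q fun x ↦ h ⟨_, x.2.1.symm⟩⟩
  exact Nat.card_of_isEmpty

end Strata

/-! ## §3 `|L(t)/O₆^×| = Σ_{c² ∣ t} P(t/c²)`; for `t = n²t₁`, `t₁` squarefree, a divisor sum over `n` -/

section SquareDivisors

/-- **`|L(t)/O₆^×| = Σ_{c² ∣ t, 1 ≤ c ≤ t} |L_prim(t/c²)/O₆^×|` for every `t > 0`** — the content stratification re-indexed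
by the primitive norm: the classes of `L(t)` are the classes of primitive vectors of the norms `t/c²`, `c² ∣ t`
(KRY's `Σ_{c∣n}` over the orders through which the special endomorphism acts; Vignéras' `Σ_B m_G(B)`).
[cite: KudlaRapoportYang2006, §3.4 (3.4.6) and Remark 3.4.7] [cite: VignerasLNM800, Ch. III §5.C Cor. 5.14] -/
theorem card_unit_classes_eq_sum_primitive {T : ℤ} (hT : 0 < T) :
    Nat.card (Quot (fun x y : {x : ℤ × ℤ × ℤ // x.1 ^ 2 - 3 * x.2.1 ^ 2 - 3 * x.2.2 ^ 2 = T} ↦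
      ∃ v : ℍ[ℚ,((-1 : ℤ) : ℚ),((3 : ℤ) : ℚ)], (v ∈ order (-1) 3 ∨ v - ⟨1/2, 1/2, 1/2, -1/2⟩ ∈ order (-1) 3) ∧
        ((v * star v).re = 1 ∨ (v * star v).re = -1) ∧
        v * ⟨0, x.1.1, x.1.2.1, x.1.2.2⟩ = ⟨0, y.1.1, y.1.2.1, y.1.2.2⟩ * v)) =
    ∑ c ∈ (Finset.Icc 1 T.toNat).filter (fun c : ℕ ↦ (c : ℤ) ^ 2 ∣ T), Nat.card (Quot (fun x y : {x : ℤ × ℤ × ℤ // x.1 ^ 2 - 3 * x.2.1 ^ 2 - 3 * x.2.2 ^ 2 = T / (c : ℤ) ^ 2 ∧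
      ∃ u : ℤ × ℤ × ℤ, u.1 * x.1 + u.2.1 * x.2.1 + u.2.2 * x.2.2 = 1} ↦
      ∃ v : ℍ[ℚ,((-1 : ℤ) : ℚ),((3 : ℤ) : ℚ)], (v ∈ order (-1) 3 ∨ v - ⟨1/2, 1/2, 1/2, -1/2⟩ ∈ order (-1) 3) ∧
        ((v * star v).re = 1 ∨ (v * star v).re = -1) ∧
        v * ⟨0, x.1.1, x.1.2.1, x.1.2.2⟩ = ⟨0, y.1.1, y.1.2.1, y.1.2.2⟩ * v)) := by
  rw [card_unit_classes_eq_sum_content hT, Finset.sum_filter]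
  refine Finset.sum_congr rfl fun c hc ↦ ?_
  have hc0 : 0 < c := by have := (Finset.mem_Icc.1 hc).1; omega
  by_cases h : (c : ℤ) ^ 2 ∣ T
  · rw [if_pos h]
    exact card_stratum_eq_card_primitive hc0 (Int.mul_ediv_cancel' h)
  · rw [if_neg h]
    exact card_stratum_eq_zero_of_not_dvd h

/-- **The square divisors of `n²t₁` (`t₁` squarefree, `n ≥ 1`) in `[1, n²t₁]` are exactly the `c²`, `c ∣ n`.**
[cite: KudlaRapoportYang2006, §3.4 (3.4.6) («`4t = n²d` … `Σ_{c∣n}`»)] [cite: Apostol1976, §2.7] -/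
theorem filter_sq_dvd_sq_mul_eq_divisors {t₁ : ℕ} (ht₁ : Squarefree t₁) {n : ℕ} (hn : 0 < n) :
    (Finset.Icc 1 ((n : ℤ) ^ 2 * (t₁ : ℤ)).toNat).filter (fun c : ℕ ↦ (c : ℤ) ^ 2 ∣ (n : ℤ) ^ 2 * (t₁ : ℤ)) = n.divisors := by
  have ht₀ : 0 < t₁ := Nat.pos_of_ne_zero ht₁.ne_zero
  ext c
  rw [Finset.mem_filter, Finset.mem_Icc, Nat.mem_divisors]
  constructor
  · rintro ⟨-, h⟩
    have h' : c ^ 2 ∣ n ^ 2 * t₁ := by exact_mod_cast h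
    exact ⟨(Literature.NumberTheory.Sieve.sq_dvd_sq_mul_iff_of_squarefree hn ht₁).1 h', hn.ne'⟩
  · rintro ⟨h, -⟩
    have hc : 0 < c := Nat.pos_of_dvd_of_pos h hn
    refine ⟨⟨hc, ?_⟩, by exact_mod_cast (Literature.NumberTheory.Sieve.sq_dvd_sq_mul_iff_of_squarefree hn ht₁).2 h⟩
    have h1 : c ≤ n := Nat.le_of_dvd hn h
    have h2 : n ≤ n ^ 2 * t₁ :=
      calc n = n * 1 * 1 := by ring
        _ ≤ n * n * t₁ := Nat.mul_le_mul (Nat.mul_le_mul_left n hn) ht₀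
        _ = n ^ 2 * t₁ := by ring
    have h3 : ((n : ℤ) ^ 2 * (t₁ : ℤ)).toNat = n ^ 2 * t₁ := by
      have e : (n : ℤ) ^ 2 * (t₁ : ℤ) = ((n ^ 2 * t₁ : ℕ) : ℤ) := by push_cast; ring
      rw [e, Int.toNat_natCast]
    rw [h3]; exact h1.trans h2

/-- **`|L(n²t₁)/O₆^×| = Σ_{i ∣ n} |L_prim(i²t₁)/O₆^×|` for `t₁` SQUAREFREE and `n ≥ 1`** — with `t₁` squarefree the square
divisors of `t = n²t₁` are exactly the `c²`, `c ∣ n` (`Sieve.sq_dvd_sq_mul_iff_of_squarefree`), and `t/c² = (n/c)²t₁`; re-indexing `c ↦ n/c`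
gives a plain divisor sum. [cite: KudlaRapoportYang2006, §3.4 (3.4.6) («`4t = n²d` … `Σ_{c∣n}`») and Remark 3.4.7] [cite: Apostol1976, §2.7] -/
theorem card_unit_classes_sq_mul_eq_sum_divisors {t₁ : ℕ} (ht₁ : Squarefree t₁) {n : ℕ} (hn : 0 < n) :
    Nat.card (Quot (fun x y : {x : ℤ × ℤ × ℤ // x.1 ^ 2 - 3 * x.2.1 ^ 2 - 3 * x.2.2 ^ 2 = (n : ℤ) ^ 2 * (t₁ : ℤ)} ↦
      ∃ v : ℍ[ℚ,((-1 : ℤ) : ℚ),((3 : ℤ) : ℚ)], (v ∈ order (-1) 3 ∨ v - ⟨1/2, 1/2, 1/2, -1/2⟩ ∈ order (-1) 3) ∧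
        ((v * star v).re = 1 ∨ (v * star v).re = -1) ∧
        v * ⟨0, x.1.1, x.1.2.1, x.1.2.2⟩ = ⟨0, y.1.1, y.1.2.1, y.1.2.2⟩ * v)) =
    ∑ i ∈ n.divisors, Nat.card (Quot (fun x y : {x : ℤ × ℤ × ℤ // x.1 ^ 2 - 3 * x.2.1 ^ 2 - 3 * x.2.2 ^ 2 = (i : ℤ) ^ 2 * (t₁ : ℤ) ∧
      ∃ u : ℤ × ℤ × ℤ, u.1 * x.1 + u.2.1 * x.2.1 + u.2.2 * x.2.2 = 1} ↦
      ∃ v : ℍ[ℚ,((-1 : ℤ) : ℚ),((3 : ℤ) : ℚ)], (v ∈ order (-1) 3 ∨ v - ⟨1/2, 1/2, 1/2, -1/2⟩ ∈ order (-1) 3) ∧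
        ((v * star v).re = 1 ∨ (v * star v).re = -1) ∧
        v * ⟨0, x.1.1, x.1.2.1, x.1.2.2⟩ = ⟨0, y.1.1, y.1.2.1, y.1.2.2⟩ * v)) := by
  have ht₀ : 0 < t₁ := Nat.pos_of_ne_zero ht₁.ne_zero
  have hT : (0 : ℤ) < (n : ℤ) ^ 2 * (t₁ : ℤ) := by positivity
  rw [card_unit_classes_eq_sum_primitive hT]
  rw [filter_sq_dvd_sq_mul_eq_divisors ht₁ hn]
  -- `have` without expected type, then `rw` (elaborating the lemma against the goal is a whnf timeout)
  have hre := (Nat.sum_div_divisors n (fun i ↦ Nat.card (Quot (fun x y : {x : ℤ × ℤ × ℤ // x.1 ^ 2 - 3 * x.2.1 ^ 2 - 3 * x.2.2 ^ 2 = (i : ℤ) ^ 2 * (t₁ : ℤ) ∧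
      ∃ u : ℤ × ℤ × ℤ, u.1 * x.1 + u.2.1 * x.2.1 + u.2.2 * x.2.2 = 1} ↦
      ∃ v : ℍ[ℚ,((-1 : ℤ) : ℚ),((3 : ℤ) : ℚ)], (v ∈ order (-1) 3 ∨ v - ⟨1/2, 1/2, 1/2, -1/2⟩ ∈ order (-1) 3) ∧
        ((v * star v).re = 1 ∨ (v * star v).re = -1) ∧
        v * ⟨0, x.1.1, x.1.2.1, x.1.2.2⟩ = ⟨0, y.1.1, y.1.2.1, y.1.2.2⟩ * v)))).symm
  rw [hre]
  refine Finset.sum_congr rfl fun c hc ↦ ?_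
  obtain ⟨hcn, -⟩ := Nat.mem_divisors.1 hc
  obtain ⟨k, rfl⟩ := hcn
  have hc0 : 0 < c := Nat.pos_of_ne_zero (by rintro rfl; simp at hn)
  refine card_primitive_congr₄₃ ?_
  rw [Nat.mul_div_cancel_left k hc0]
  push_cast
  rw [show ((c : ℤ) * (k : ℤ)) ^ 2 * (t₁ : ℤ) = (c : ℤ) ^ 2 * ((k : ℤ) ^ 2 * (t₁ : ℤ)) by ring,
    Int.mul_ediv_cancel_left _ (by positivity : (c : ℤ) ^ 2 ≠ 0)]

end SquareDivisors

/-! ## §4 Möbius inversion -/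

section Moebius

/-- **MÖBIUS INVERSION FOR THE PRIMITIVE CLASS NUMBERS: `|L_prim(n²t₁)/O₆^×| = Σ_{ab = n} μ(a)·|L(b²t₁)/O₆^×|`** for `t₁`
squarefree and `n ≥ 1` — the divisor-sum relation `|L(n²t₁)/O₆^×| = Σ_{i ∣ n} P(i²t₁)` of §3 inverted (Mathlib's
`ArithmeticFunction.sum_eq_iff_sum_mul_moebius_eq`); the primitive counts — Vignéras' embedding numbers of the single order
optimally embedded — are integral combinations of Kudla–Rapoport–Yang's class numbers `|L(t)/O_B^×|`.
[cite: Apostol1976, §2.7 Thm. 2.9] [cite: KudlaRapoportYang2006, §3.4 (3.4.6) and Remark 3.4.7] [cite: VignerasLNM800, Ch. III §5.C Cor. 5.11–5.14] -/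
theorem card_primitive_eq_sum_moebius {t₁ : ℕ} (ht₁ : Squarefree t₁) {n : ℕ} (hn : 0 < n) :
    (Nat.card (Quot (fun x y : {x : ℤ × ℤ × ℤ // x.1 ^ 2 - 3 * x.2.1 ^ 2 - 3 * x.2.2 ^ 2 = (n : ℤ) ^ 2 * (t₁ : ℤ) ∧
      ∃ u : ℤ × ℤ × ℤ, u.1 * x.1 + u.2.1 * x.2.1 + u.2.2 * x.2.2 = 1} ↦
      ∃ v : ℍ[ℚ,((-1 : ℤ) : ℚ),((3 : ℤ) : ℚ)], (v ∈ order (-1) 3 ∨ v - ⟨1/2, 1/2, 1/2, -1/2⟩ ∈ order (-1) 3) ∧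
        ((v * star v).re = 1 ∨ (v * star v).re = -1) ∧
        v * ⟨0, x.1.1, x.1.2.1, x.1.2.2⟩ = ⟨0, y.1.1, y.1.2.1, y.1.2.2⟩ * v)) : ℤ) =
    ∑ ab ∈ n.divisorsAntidiagonal,
      ArithmeticFunction.moebius ab.1 * (Nat.card (Quot (fun x y : {x : ℤ × ℤ × ℤ // x.1 ^ 2 - 3 * x.2.1 ^ 2 - 3 * x.2.2 ^ 2 = (ab.2 : ℤ) ^ 2 * (t₁ : ℤ)} ↦
      ∃ v : ℍ[ℚ,((-1 : ℤ) : ℚ),((3 : ℤ) : ℚ)], (v ∈ order (-1) 3 ∨ v - ⟨1/2, 1/2, 1/2, -1/2⟩ ∈ order (-1) 3) ∧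
        ((v * star v).re = 1 ∨ (v * star v).re = -1) ∧
        v * ⟨0, x.1.1, x.1.2.1, x.1.2.2⟩ = ⟨0, y.1.1, y.1.2.1, y.1.2.2⟩ * v)) : ℤ) := by
  have key := (ArithmeticFunction.sum_eq_iff_sum_mul_moebius_eq (R := ℤ)
    (f := fun i : ℕ ↦ (Nat.card (Quot (fun x y : {x : ℤ × ℤ × ℤ // x.1 ^ 2 - 3 * x.2.1 ^ 2 - 3 * x.2.2 ^ 2 = (i : ℤ) ^ 2 * (t₁ : ℤ) ∧
      ∃ u : ℤ × ℤ × ℤ, u.1 * x.1 + u.2.1 * x.2.1 + u.2.2 * x.2.2 = 1} ↦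
      ∃ v : ℍ[ℚ,((-1 : ℤ) : ℚ),((3 : ℤ) : ℚ)], (v ∈ order (-1) 3 ∨ v - ⟨1/2, 1/2, 1/2, -1/2⟩ ∈ order (-1) 3) ∧
        ((v * star v).re = 1 ∨ (v * star v).re = -1) ∧
        v * ⟨0, x.1.1, x.1.2.1, x.1.2.2⟩ = ⟨0, y.1.1, y.1.2.1, y.1.2.2⟩ * v)) : ℤ))
    (g := fun m : ℕ ↦ (Nat.card (Quot (fun x y : {x : ℤ × ℤ × ℤ // x.1 ^ 2 - 3 * x.2.1 ^ 2 - 3 * x.2.2 ^ 2 = (m : ℤ) ^ 2 * (t₁ : ℤ)} ↦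
      ∃ v : ℍ[ℚ,((-1 : ℤ) : ℚ),((3 : ℤ) : ℚ)], (v ∈ order (-1) 3 ∨ v - ⟨1/2, 1/2, 1/2, -1/2⟩ ∈ order (-1) 3) ∧
        ((v * star v).re = 1 ∨ (v * star v).re = -1) ∧
        v * ⟨0, x.1.1, x.1.2.1, x.1.2.2⟩ = ⟨0, y.1.1, y.1.2.1, y.1.2.2⟩ * v)) : ℤ))).1
    (fun m hm ↦ by exact_mod_cast (card_unit_classes_sq_mul_eq_sum_divisors ht₁ hm).symm) n hn
  simpa only [Int.cast_id] using key.symm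

end Moebius

/-! ## §5 Values: `P(1) = P(3) = 2`, `P(25) = P(75) = 4`, `P(100) = 0` -/

section Values

/-- **`|L_prim(1)/O₆^×| = 2`** (every vector of norm `1` is primitive; the classes `[±i]`). [cite: KudlaRapoportYang2006, §3.4 (3.4.8) and Lemma 3.4.3] -/
theorem card_primitive_one :
    Nat.card (Quot (fun x y : {x : ℤ × ℤ × ℤ // x.1 ^ 2 - 3 * x.2.1 ^ 2 - 3 * x.2.2 ^ 2 = 1 ∧
      ∃ u : ℤ × ℤ × ℤ, u.1 * x.1 + u.2.1 * x.2.1 + u.2.2 * x.2.2 = 1} ↦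
      ∃ v : ℍ[ℚ,((-1 : ℤ) : ℚ),((3 : ℤ) : ℚ)], (v ∈ order (-1) 3 ∨ v - ⟨1/2, 1/2, 1/2, -1/2⟩ ∈ order (-1) 3) ∧
        ((v * star v).re = 1 ∨ (v * star v).re = -1) ∧
        v * ⟨0, x.1.1, x.1.2.1, x.1.2.2⟩ = ⟨0, y.1.1, y.1.2.1, y.1.2.2⟩ * v)) = 2 :=
  (card_stratum_eq_card_primitive (T := 1) (c := 1) one_pos (by norm_num)).symm.trans
    (card_stratum_of_sq_eq one_pos (by norm_num))

/-- **`|L_prim(3)/O₆^×| = 2`** (every vector of norm `3` is primitive). [cite: KudlaRapoportYang2006, §3.4 (3.4.8)] [cite: BayerTravesa2007, §1 Thm. 1.1] -/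
theorem card_primitive_three :
    Nat.card (Quot (fun x y : {x : ℤ × ℤ × ℤ // x.1 ^ 2 - 3 * x.2.1 ^ 2 - 3 * x.2.2 ^ 2 = 3 ∧
      ∃ u : ℤ × ℤ × ℤ, u.1 * x.1 + u.2.1 * x.2.1 + u.2.2 * x.2.2 = 1} ↦
      ∃ v : ℍ[ℚ,((-1 : ℤ) : ℚ),((3 : ℤ) : ℚ)], (v ∈ order (-1) 3 ∨ v - ⟨1/2, 1/2, 1/2, -1/2⟩ ∈ order (-1) 3) ∧
        ((v * star v).re = 1 ∨ (v * star v).re = -1) ∧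
        v * ⟨0, x.1.1, x.1.2.1, x.1.2.2⟩ = ⟨0, y.1.1, y.1.2.1, y.1.2.2⟩ * v)) = 2 :=
  (card_stratum_eq_card_primitive (T := 3) (c := 1) one_pos (by norm_num)).symm.trans
    (card_stratum_of_three_mul_sq_eq one_pos (by norm_num))

/-- **`|L_prim(25)/O₆^×| = |L(25)/O₆^×| − |L(1)/O₆^×| = 6 − 2 = 4`** (`n = 5`, `t₁ = 1`: `μ(1)·6 + μ(5)·2`) — the embedding
number of the order of discriminant `−100` into `O₆` modulo `O₆^×`: `δ(4; 6)·h(−100) = 2·2` on the class-number side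
(`degree_formula_twentyfive`). [cite: KudlaRapoportYang2006, §3.4 (3.4.6)] [cite: VignerasLNM800, Ch. III §5.C Cor. 5.12] [cite: Apostol1976, §2.7 Thm. 2.9] -/
theorem card_primitive_twentyfive :
    Nat.card (Quot (fun x y : {x : ℤ × ℤ × ℤ // x.1 ^ 2 - 3 * x.2.1 ^ 2 - 3 * x.2.2 ^ 2 = 25 ∧
      ∃ u : ℤ × ℤ × ℤ, u.1 * x.1 + u.2.1 * x.2.1 + u.2.2 * x.2.2 = 1} ↦
      ∃ v : ℍ[ℚ,((-1 : ℤ) : ℚ),((3 : ℤ) : ℚ)], (v ∈ order (-1) 3 ∨ v - ⟨1/2, 1/2, 1/2, -1/2⟩ ∈ order (-1) 3) ∧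
        ((v * star v).re = 1 ∨ (v * star v).re = -1) ∧
        v * ⟨0, x.1.1, x.1.2.1, x.1.2.2⟩ = ⟨0, y.1.1, y.1.2.1, y.1.2.2⟩ * v)) = 4 := by
  have h := card_primitive_eq_sum_moebius (t₁ := 1) squarefree_one (n := 5) (by norm_num)
  rw [show Nat.divisorsAntidiagonal 5 = {(1, 5), (5, 1)} from by decide, Finset.sum_pair (show ((1, 5) : ℕ × ℕ) ≠ (5, 1) by decide)] at h
  have e25 : Nat.card (Quot (fun x y : {x : ℤ × ℤ × ℤ // x.1 ^ 2 - 3 * x.2.1 ^ 2 - 3 * x.2.2 ^ 2 = ((5 : ℕ) : ℤ) ^ 2 * ((1 : ℕ) : ℤ)} ↦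
      ∃ v : ℍ[ℚ,((-1 : ℤ) : ℚ),((3 : ℤ) : ℚ)], (v ∈ order (-1) 3 ∨ v - ⟨1/2, 1/2, 1/2, -1/2⟩ ∈ order (-1) 3) ∧
        ((v * star v).re = 1 ∨ (v * star v).re = -1) ∧
        v * ⟨0, x.1.1, x.1.2.1, x.1.2.2⟩ = ⟨0, y.1.1, y.1.2.1, y.1.2.2⟩ * v)) = 6 :=
    (card_unit_classes_congr₄₃ (by norm_num)).trans card_unit_classes_twentyfive
  have e1 : Nat.card (Quot (fun x y : {x : ℤ × ℤ × ℤ // x.1 ^ 2 - 3 * x.2.1 ^ 2 - 3 * x.2.2 ^ 2 = ((1 : ℕ) : ℤ) ^ 2 * ((1 : ℕ) : ℤ)} ↦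
      ∃ v : ℍ[ℚ,((-1 : ℤ) : ℚ),((3 : ℤ) : ℚ)], (v ∈ order (-1) 3 ∨ v - ⟨1/2, 1/2, 1/2, -1/2⟩ ∈ order (-1) 3) ∧
        ((v * star v).re = 1 ∨ (v * star v).re = -1) ∧
        v * ⟨0, x.1.1, x.1.2.1, x.1.2.2⟩ = ⟨0, y.1.1, y.1.2.1, y.1.2.2⟩ * v)) = 2 :=
    (card_unit_classes_congr₄₃ (by norm_num)).trans card_unit_classes_one
  have eP : Nat.card (Quot (fun x y : {x : ℤ × ℤ × ℤ // x.1 ^ 2 - 3 * x.2.1 ^ 2 - 3 * x.2.2 ^ 2 = ((5 : ℕ) : ℤ) ^ 2 * ((1 : ℕ) : ℤ) ∧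
      ∃ u : ℤ × ℤ × ℤ, u.1 * x.1 + u.2.1 * x.2.1 + u.2.2 * x.2.2 = 1} ↦
      ∃ v : ℍ[ℚ,((-1 : ℤ) : ℚ),((3 : ℤ) : ℚ)], (v ∈ order (-1) 3 ∨ v - ⟨1/2, 1/2, 1/2, -1/2⟩ ∈ order (-1) 3) ∧
        ((v * star v).re = 1 ∨ (v * star v).re = -1) ∧
        v * ⟨0, x.1.1, x.1.2.1, x.1.2.2⟩ = ⟨0, y.1.1, y.1.2.1, y.1.2.2⟩ * v)) =
      Nat.card (Quot (fun x y : {x : ℤ × ℤ × ℤ // x.1 ^ 2 - 3 * x.2.1 ^ 2 - 3 * x.2.2 ^ 2 = 25 ∧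
      ∃ u : ℤ × ℤ × ℤ, u.1 * x.1 + u.2.1 * x.2.1 + u.2.2 * x.2.2 = 1} ↦
      ∃ v : ℍ[ℚ,((-1 : ℤ) : ℚ),((3 : ℤ) : ℚ)], (v ∈ order (-1) 3 ∨ v - ⟨1/2, 1/2, 1/2, -1/2⟩ ∈ order (-1) 3) ∧
        ((v * star v).re = 1 ∨ (v * star v).re = -1) ∧
        v * ⟨0, x.1.1, x.1.2.1, x.1.2.2⟩ = ⟨0, y.1.1, y.1.2.1, y.1.2.2⟩ * v)) := card_primitive_congr₄₃ (by norm_num)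
  simp only [e25, e1, eP, ArithmeticFunction.moebius_apply_one,
    ArithmeticFunction.moebius_apply_prime Nat.prime_five] at h
  omega

/-- **`|L_prim(75)/O₆^×| = |L(75)/O₆^×| − |L(3)/O₆^×| = 6 − 2 = 4`** (`n = 5`, `t₁ = 3`) — the embedding number of the order
of discriminant `−75`: `δ(3; 6)·h(−75) = 2·2` (`degree_formula_seventyfive`). [cite: KudlaRapoportYang2006, §3.4 (3.4.6)] [cite: VignerasLNM800, Ch. III §5.C Cor. 5.12] [cite: Apostol1976, §2.7 Thm. 2.9] -/
theorem card_primitive_seventyfive :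
    Nat.card (Quot (fun x y : {x : ℤ × ℤ × ℤ // x.1 ^ 2 - 3 * x.2.1 ^ 2 - 3 * x.2.2 ^ 2 = 75 ∧
      ∃ u : ℤ × ℤ × ℤ, u.1 * x.1 + u.2.1 * x.2.1 + u.2.2 * x.2.2 = 1} ↦
      ∃ v : ℍ[ℚ,((-1 : ℤ) : ℚ),((3 : ℤ) : ℚ)], (v ∈ order (-1) 3 ∨ v - ⟨1/2, 1/2, 1/2, -1/2⟩ ∈ order (-1) 3) ∧
        ((v * star v).re = 1 ∨ (v * star v).re = -1) ∧
        v * ⟨0, x.1.1, x.1.2.1, x.1.2.2⟩ = ⟨0, y.1.1, y.1.2.1, y.1.2.2⟩ * v)) = 4 := by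
  have h3 : Squarefree (3 : ℕ) := Nat.prime_three.prime.squarefree
  have h := card_primitive_eq_sum_moebius (t₁ := 3) h3 (n := 5) (by norm_num)
  rw [show Nat.divisorsAntidiagonal 5 = {(1, 5), (5, 1)} from by decide, Finset.sum_pair (show ((1, 5) : ℕ × ℕ) ≠ (5, 1) by decide)] at h
  have e75 : Nat.card (Quot (fun x y : {x : ℤ × ℤ × ℤ // x.1 ^ 2 - 3 * x.2.1 ^ 2 - 3 * x.2.2 ^ 2 = ((5 : ℕ) : ℤ) ^ 2 * ((3 : ℕ) : ℤ)} ↦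
      ∃ v : ℍ[ℚ,((-1 : ℤ) : ℚ),((3 : ℤ) : ℚ)], (v ∈ order (-1) 3 ∨ v - ⟨1/2, 1/2, 1/2, -1/2⟩ ∈ order (-1) 3) ∧
        ((v * star v).re = 1 ∨ (v * star v).re = -1) ∧
        v * ⟨0, x.1.1, x.1.2.1, x.1.2.2⟩ = ⟨0, y.1.1, y.1.2.1, y.1.2.2⟩ * v)) = 6 :=
    (card_unit_classes_congr₄₃ (by norm_num)).trans card_unit_classes_seventyfive
  have e3 : Nat.card (Quot (fun x y : {x : ℤ × ℤ × ℤ // x.1 ^ 2 - 3 * x.2.1 ^ 2 - 3 * x.2.2 ^ 2 = ((1 : ℕ) : ℤ) ^ 2 * ((3 : ℕ) : ℤ)} ↦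
      ∃ v : ℍ[ℚ,((-1 : ℤ) : ℚ),((3 : ℤ) : ℚ)], (v ∈ order (-1) 3 ∨ v - ⟨1/2, 1/2, 1/2, -1/2⟩ ∈ order (-1) 3) ∧
        ((v * star v).re = 1 ∨ (v * star v).re = -1) ∧
        v * ⟨0, x.1.1, x.1.2.1, x.1.2.2⟩ = ⟨0, y.1.1, y.1.2.1, y.1.2.2⟩ * v)) = 2 :=
    (card_unit_classes_congr₄₃ (by norm_num)).trans card_unit_classes_three
  have eP : Nat.card (Quot (fun x y : {x : ℤ × ℤ × ℤ // x.1 ^ 2 - 3 * x.2.1 ^ 2 - 3 * x.2.2 ^ 2 = ((5 : ℕ) : ℤ) ^ 2 * ((3 : ℕ) : ℤ) ∧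
      ∃ u : ℤ × ℤ × ℤ, u.1 * x.1 + u.2.1 * x.2.1 + u.2.2 * x.2.2 = 1} ↦
      ∃ v : ℍ[ℚ,((-1 : ℤ) : ℚ),((3 : ℤ) : ℚ)], (v ∈ order (-1) 3 ∨ v - ⟨1/2, 1/2, 1/2, -1/2⟩ ∈ order (-1) 3) ∧
        ((v * star v).re = 1 ∨ (v * star v).re = -1) ∧
        v * ⟨0, x.1.1, x.1.2.1, x.1.2.2⟩ = ⟨0, y.1.1, y.1.2.1, y.1.2.2⟩ * v)) =
      Nat.card (Quot (fun x y : {x : ℤ × ℤ × ℤ // x.1 ^ 2 - 3 * x.2.1 ^ 2 - 3 * x.2.2 ^ 2 = 75 ∧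
      ∃ u : ℤ × ℤ × ℤ, u.1 * x.1 + u.2.1 * x.2.1 + u.2.2 * x.2.2 = 1} ↦
      ∃ v : ℍ[ℚ,((-1 : ℤ) : ℚ),((3 : ℤ) : ℚ)], (v ∈ order (-1) 3 ∨ v - ⟨1/2, 1/2, 1/2, -1/2⟩ ∈ order (-1) 3) ∧
        ((v * star v).re = 1 ∨ (v * star v).re = -1) ∧
        v * ⟨0, x.1.1, x.1.2.1, x.1.2.2⟩ = ⟨0, y.1.1, y.1.2.1, y.1.2.2⟩ * v)) := card_primitive_congr₄₃ (by norm_num)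
  simp only [e75, e3, eP, ArithmeticFunction.moebius_apply_one,
    ArithmeticFunction.moebius_apply_prime Nat.prime_five] at h
  omega

/-- **`|L_prim(100)/O₆^×| = 0`: no primitive vector has norm divisible by `4`** (`not_four_dvd_norm_of_primitive`, the
ramified prime `2`) — consistent with Möbius: `|L(100)| − |L(25)| − |L(4)| + |L(1)| = 6 − 6 − 2 + 2 = 0`; the order `ℤ[10i]`
(conductor `2·5`, not maximal at `2`) has no optimal embedding into `O₆`. [cite: KudlaRapoportYang2006, §3.4 (3.4.6) («`(c, D) = 1`») and Remark 3.4.7] [cite: VignerasLNM800, Ch. II §3 («Si `B` n'est pas maximal, il ne se plonge pas maximalement dans `O`»)] -/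
theorem card_primitive_hundred :
    Nat.card (Quot (fun x y : {x : ℤ × ℤ × ℤ // x.1 ^ 2 - 3 * x.2.1 ^ 2 - 3 * x.2.2 ^ 2 = 100 ∧
      ∃ u : ℤ × ℤ × ℤ, u.1 * x.1 + u.2.1 * x.2.1 + u.2.2 * x.2.2 = 1} ↦
      ∃ v : ℍ[ℚ,((-1 : ℤ) : ℚ),((3 : ℤ) : ℚ)], (v ∈ order (-1) 3 ∨ v - ⟨1/2, 1/2, 1/2, -1/2⟩ ∈ order (-1) 3) ∧
        ((v * star v).re = 1 ∨ (v * star v).re = -1) ∧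
        v * ⟨0, x.1.1, x.1.2.1, x.1.2.2⟩ = ⟨0, y.1.1, y.1.2.1, y.1.2.2⟩ * v)) = 0 := by
  haveI : IsEmpty (Quot (fun x y : {x : ℤ × ℤ × ℤ // x.1 ^ 2 - 3 * x.2.1 ^ 2 - 3 * x.2.2 ^ 2 = 100 ∧
      ∃ u : ℤ × ℤ × ℤ, u.1 * x.1 + u.2.1 * x.2.1 + u.2.2 * x.2.2 = 1} ↦
      ∃ v : ℍ[ℚ,((-1 : ℤ) : ℚ),((3 : ℤ) : ℚ)], (v ∈ order (-1) 3 ∨ v - ⟨1/2, 1/2, 1/2, -1/2⟩ ∈ order (-1) 3) ∧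
        ((v * star v).re = 1 ∨ (v * star v).re = -1) ∧
        v * ⟨0, x.1.1, x.1.2.1, x.1.2.2⟩ = ⟨0, y.1.1, y.1.2.1, y.1.2.2⟩ * v)) := ⟨fun q ↦ Quot.inductionOn q fun x ↦ by
    have h4 := not_four_dvd_norm_of_primitive (prim_fin₄₃ x.2.2)
    exact h4 ⟨25, by
      simp only [Matrix.cons_val_zero, Matrix.cons_val_one, Matrix.head_cons, Matrix.cons_val_two, Matrix.tail_cons]
      linarith [x.2.1]⟩⟩
  exact Nat.card_of_isEmpty

end Values

end Literature.Geometry.Kaehler.ComplexTorus.QuaternionType
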